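import Literature.AlgebraicGeometry.HodgeTheory.VHSDataHodgeLocusInteriorChartHolomorphicLift
import Literature.AlgebraicGeometry.HodgeTheory.VHSDataDeterminationLocusOverCurve
import Literature.Topology.PuncturedChartEnds
import HarnessLib

/-!
# Cattani–Deligne–Kaplan, Theorem 1.1 / Corollaries 1.2–1.3 for `VHSData` over a PUNCTURED COMPACT CURVE `S = S̄ ∖ {p₁, …, p_m}`: the
# topological hypotheses («open ends», «compact core») discharged by the model of a compactification with disc charts at the punctures

Topic `Literature/AlgebraicGeometry/HodgeTheory` (namespace `Literature.AlgebraicGeometry.Motives.VHSData`), lane `lit-hodgefound` (seat `p08`,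
row g55-#3).  THEOREMS ONLY (no definition, no named fact, no instance; D-0026 net debt `0`).  The JUNCTION of
`Topology/PuncturedChartEnds.lean` (ends `σᵢ{Im z > A} = j⁻¹(φᵢ⁻¹(D*(e^{−2πA})))` are open; `X` compact ⟹ compact core) with the tree's
one-dimensional CDK theorems `VHSData.hodgeLocusOfNormLe_eq_univ_or_finite` (`HodgeTheory/VHSDataHodgeLocusOverCurve` §2),
`VHSData.hodgeLocusOfNormLe_eq_univ_or_finite_of_lift` (`HodgeTheory/VHSDataHodgeLocusInteriorChartHolomorphicLift` §5) and
`VHSData.determinationLocus_eq_univ_or_finite` (`HodgeTheory/VHSDataDeterminationLocusOverCurve` §3), whose hypotheses `hopen` ∕ `hcore` were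
abstract.

PRINTED SOURCE, VERBATIM (E. Cattani, P. Deligne, A. Kaplan, *On the locus of Hodge classes*, J. Amer. Math. Soc. 8 (1995) 483–506; held text
`paper:arxiv-alg-geom_9402009`).  «**Theorem 1.1.** `S^{(K)}` is an algebraic variety, finite over `S`.  **Corollary 1.2.** Fix `s ∈ S` and `u ∈ 𝒱_s`
integral of type `(0, 0)`. The germ of analytic subvariety of `S` where `u` remains of type `(0, 0)`, is algebraic.  **Corollary 1.3.** Let `u` be a
section of the local system `𝒱_ℤ` on a universal covering of `S`. The set of points in `S` where some determination of `u` is of type `(0,0)`, is an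
algebraic subvariety of `S`.» (p. 484); «Proof of 1.5 ⟹ 1.1: … Let `S̄` be a smooth compactification of `S`, with `S̄ − S` a divisor with normal
crossings. … in a neighborhood of any point in `S̄ − S`, one is in the situation considered in 1.5. One concludes that `S^{(K)}` can be extended
to a space `S̄^{(K)}` over `S̄` … By GAGA, `S̄^{(K)}`, finite over `S̄`, is algebraic, and 1.1 follows.» (p. 485); 2.3 (p. 487): «The Poincaré upper
half-plane `ℍ` is the universal covering of `D*`, with covering map `z ↦ s = e^{2πiz}`».

THE ONE-DIMENSIONAL MODEL (hypotheses, no manifold theory): `X` a COMPACT topological space (the compactification `S̄`), `j : S → X` an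
embedding of the preconnected base `S`, finitely or arbitrarily many punctures `pt : ι → X` off `j(S)` covering `X ∖ j(S)`, charts
`φ i : OpenPartialHomeomorph X ℂ` centred at `pt i` whose targets contain the discs `D(e^{−2πA₀ i})`, and the uniformisations `σ i : ℂ → S`,
`j (σ i z) = (φ i)⁻¹(e^{2πiz})` for `Im z > A₀ i`, which are AT THE SAME TIME the maps of the local period charts at the punctures (the
hypotheses `hF`, `hQ`, `hΛ₁`, `hΛ₂` of `VHSDataHodgeLocusNearPuncture`: unipotent local monodromy, Schmid's nilpotent orbit theorem in the
holomorphic gauge).  Under these, `Literature.Topology.isOpen_image_ends` and `Literature.Topology.exists_isCompact_core` furnish `hopen` and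
`hcore`, and:
* §1 **`hodgeLocusOfNormLe_eq_univ_or_finite_of_compactification`** — THM 1.1 ∕ COR 1.2 (`r = 1`): the Hodge locus of norm `≤ K` is ALL of
  `S` or FINITE (flat interior charts with a metric comparison, as in `VHSDataHodgeLocusOverCurve`);
* §2 **`hodgeLocusOfNormLe_eq_univ_or_finite_of_lift_of_compactification`** — the same with holomorphic-lift interior charts
  (`VHSDataHodgeLocusInteriorChartHolomorphicLift`);
* §3 **`determinationLocus_eq_univ_or_finite_of_compactification`** — COR 1.3 (`r = 1`): the set of points where SOME determination of an
  integral `u₀` is of type `(p, p)` is ALL of `S` or FINITE;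
* §4 `hopen ∧ hcore` packaged for the other one-dimensional assemblies; Cor. 1.3 read off: infinite ⟹ everything (for «one point
  outside ⟹ finite» use the tree's `hodgeLocusOfNormLe_finite_of_not_mem`).

HONEST SCOPE: that a smooth complex algebraic curve `S(ℂ)` sits in its smooth compactification with disc charts at the finitely many points
at infinity, that `S(ℂ)` is connected, and that an honest polarized `ℤ`VHS with unipotent local monodromies furnishes the period charts
(holomorphy of the Hodge bundles, Schmid) are NOT proved here — they are exactly the displayed hypotheses.  Quasi-unipotent monodromy (the
finite étale cover), `dim S > 1` (GAGA): not here.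

## References

* [CattaniDeligneKaplan1995] E. Cattani, P. Deligne, A. Kaplan, *On the locus of Hodge classes*, J. Amer. Math. Soc. 8 (1995) 483–506: Thm. 1.1,
  Cor. 1.2, Cor. 1.3 (p. 484), «Proof of 1.5 ⟹ 1.1» (p. 485), 2.3 (p. 487).
* [Schmid1973] W. Schmid, *Variation of Hodge structure: the singularities of the period mapping*, Invent. Math. 22 (1973): §2, (4.12) (cite
  only: the charts).
-/

noncomputable section

open scoped TensorProduct ComplexOrder
open _root_.Topology _root_.Filter Set

namespace Literature.AlgebraicGeometry

open Module
open Motives Motives.MixedHodgeStructure Motives.HodgeStructure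
open Motives.HodgeStructure (conj ofRat ofRat_apply conj_ofRat)
open HodgeTheory

universe u

namespace Motives.VHSData

variable {S : Type} [TopologicalSpace S] {k : ℤ} (D : VHSData S k)
variable {V : Type u} [AddCommGroup V] [Module ℚ V] [FiniteDimensional ℚ V]
variable {X : Type*} [TopologicalSpace X] [CompactSpace X]

/-! ## §1 Theorem 1.1 (`r = 1`) over a punctured compact curve, flat interior charts -/

/-- **Cattani–Deligne–Kaplan, THEOREM 1.1 / COROLLARY 1.2 for `D : VHSData S k` (`k = p + p`) over a PUNCTURED COMPACT CURVE.**  `S` preconnected,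
embedded by `j` in a COMPACT `X` with `X ∖ j(S) ⊆ {pt i}`, `pt i ∉ j(S)`; disc charts `φ i` of `X` centred at `pt i` (`φ i (pt i) = 0`,
`D(e^{−2πA₀ i}) ⊆` target); uniformisations `σ i : ℂ → S` with `j (σ i z) = (φ i)⁻¹(e^{2πiz})` (`Im z > A₀ i`) carrying the local period charts with
unipotent monodromy at the punctures (`Lᵢ, Γᵢ, Λᵢ, eᵢ`: `F^p ↦ exp(zNᵢ)exp(Γᵢ(e^{2πiz}))Fᵢ^p`, `Q ↦ Qᵢ`, `V_ℤ` onto `Λᵢ`); flat interior charts with a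
metric comparison at every point of `S` (as in `hodgeLocusOfNormLe_eq_univ_or_finite`).  Then **`hodgeLocusOfNormLe D p K` is ALL of `S` or a
FINITE set** — «`S^{(K)}` is an algebraic variety, finite over `S`» read on the curve `S = S̄ ∖ {pt i}`; the open ends and the compact core of the
abstract theorem are supplied by `Topology/PuncturedChartEnds`. [cite: CattaniDeligneKaplan1995, Thm. 1.1, Cor. 1.2 (p. 484), «Proof of 1.5 ⟹ 1.1» (p. 485), 2.3 (p. 487)]
[cite: Schmid1973, (4.12) (cite only)] -/
theorem hodgeLocusOfNormLe_eq_univ_or_finite_of_compactification [PreconnectedSpace S] {p : ℤ} (hpk : p + p = k) (K : ℤ)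
    -- interior charts at every point
    (hint : ∀ x : S, ∃ ψ : OpenPartialHomeomorph S ℂ, x ∈ ψ.source ∧ IsPreconnected ψ.target ∧
      ∃ (e : ∀ c : ℂ, D.V.fiber (ψ.symm c) ≃ₗ[ℚ] V) (H₀ : HodgeStructure V k) (P₀ : H₀.Polarization) (h : ℂ → Module.End ℂ (ℂ ⊗[ℚ] V))
        (Λ₀ : Submodule ℤ V) (κ : ℝ),
        (∀ (φ : Module.Dual ℂ (ℂ ⊗[ℚ] V)) (w : ℂ ⊗[ℚ] V), AnalyticOnNhd ℂ (fun c => φ (h c w)) ψ.target) ∧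
        (∀ c ∈ ψ.target, ((D.hodge (ψ.symm c)).F p).map ((e c).toLinearMap.baseChange ℂ) = (H₀.F p).comap (h c)) ∧
        (∀ c ∈ ψ.target, ∀ x y : D.V.fiber (ψ.symm c), (D.form (ψ.symm c)).form x y = P₀.form (e c x) (e c y)) ∧
        Λ₀.FG ∧ (∀ c ∈ ψ.target, ∀ u : D.VZ.fiber (ψ.symm c), e c (D.toRat (ψ.symm c) u) ∈ Λ₀) ∧
        (∀ c ∈ ψ.target, ∀ v ∈ Λ₀, ∃ u : D.VZ.fiber (ψ.symm c), e c (D.toRat (ψ.symm c) u) = v) ∧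
        0 < κ ∧ (∀ c ∈ ψ.target, ∀ x : D.V.fiber (ψ.symm c), κ * P₀.hodgeNorm (ofRat (e c x)) ≤ (D.form (ψ.symm c)).hodgeNorm (ofRat x)))
    -- puncture charts
    {ι : Type*} (L : ι → PolarizedLimitMixedHodgeStructure V k) (Γ : ι → ℂ → Module.End ℂ (ℂ ⊗[ℚ] V)) (hΓ0 : ∀ i, Γ i 0 = 0)
    (hΓan : ∀ (i : ι) (φ : Module.Dual ℂ (ℂ ⊗[ℚ] V)) (w : ℂ ⊗[ℚ] V), AnalyticAt ℂ (fun s => φ (Γ i s w)) 0)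
    (hΓb : ∀ (i : ι) (s : ℂ), Γ i s ∈ ⨆ ab ∈ {ab : ℤ × ℤ | ab.1 ≤ -1}, (L i).toMixedHodgeStructure.endPiece ab.1 ab.2)
    (Λ : ι → Submodule ℤ V) (hΛ : ∀ i, (Λ i).FG) (hΛT : ∀ i, ∀ u ∈ Λ i, (L i).monodromy u ∈ Λ i)
    (σ : ι → ℂ → S) (e : ∀ (i : ι) (z : ℂ), D.V.fiber (σ i z) ≃ₗ[ℚ] V) (A₀ : ι → ℝ)
    (hF : ∀ (i : ι) (z : ℂ), A₀ i ≤ z.im → ((D.hodge (σ i z)).F p).map ((e i z).toLinearMap.baseChange ℂ) =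
      (((L i).F p).map (IsNilpotent.exp (Γ i (Complex.exp (2 * Real.pi * Complex.I * z))))).map (IsNilpotent.exp (z • (L i).N.baseChange ℂ)))
    (hQ : ∀ (i : ι) (z : ℂ), A₀ i ≤ z.im → ∀ x y : D.V.fiber (σ i z), (D.form (σ i z)).form x y = (L i).Q (e i z x) (e i z y))
    (hΛ₁ : ∀ (i : ι) (z : ℂ), A₀ i ≤ z.im → ∀ u : D.VZ.fiber (σ i z), e i z (D.toRat (σ i z) u) ∈ Λ i)
    (hΛ₂ : ∀ (i : ι) (z : ℂ), A₀ i ≤ z.im → ∀ v ∈ Λ i, ∃ u : D.VZ.fiber (σ i z), e i z (D.toRat (σ i z) u) = v)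
    -- the compactification with disc charts at the punctures, uniformised by the same `σ i`
    {j : S → X} (hj : IsEmbedding j) (pt : ι → X) (hpS : ∀ i, pt i ∉ range j) (hcov : ∀ x : X, x ∉ range j → ∃ i, x = pt i)
    (φ : ι → OpenPartialHomeomorph X ℂ) (hp : ∀ i, pt i ∈ (φ i).source) (hφp : ∀ i, φ i (pt i) = 0)
    (hball : ∀ i, Metric.ball (0 : ℂ) (Real.exp (-(2 * Real.pi * A₀ i))) ⊆ (φ i).target)
    (hσ : ∀ (i : ι) (z : ℂ), A₀ i < z.im → j (σ i z) = (φ i).symm (Complex.exp (2 * Real.pi * Complex.I * z))) :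
    D.hodgeLocusOfNormLe p K = univ ∨ (D.hodgeLocusOfNormLe p K).Finite :=
  D.hodgeLocusOfNormLe_eq_univ_or_finite hpk K hint L Γ hΓ0 hΓan hΓb Λ hΛ hΛT σ e A₀ hF hQ hΛ₁ hΛ₂
    (Literature.Topology.isOpen_image_ends hj φ A₀ hball σ hσ)
    (Literature.Topology.exists_isCompact_core hj pt hpS hcov φ hp hφp A₀ hball σ hσ)

/-! ## §2 Theorem 1.1 (`r = 1`) over a punctured compact curve, holomorphic-lift interior charts -/

/-- **THEOREM 1.1 / COROLLARY 1.2 (`r = 1`) over a PUNCTURED COMPACT CURVE, the interior charts given by HOLOMORPHIC LIFTS of the period map**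
(hypotheses of `hodgeLocusOfNormLe_eq_univ_or_finite_of_lift` at the interior points; punctures, compactification, disc charts and uniformisations
as in §1).  Then **`hodgeLocusOfNormLe D p K` is ALL of `S` or FINITE.** [cite: CattaniDeligneKaplan1995, Thm. 1.1, Cor. 1.2 (p. 484), «Proof of 1.5 ⟹ 1.1» (p. 485), 2.3 (p. 487)]
[cite: CattaniKaplanSchmid1987, §3 proof of Cor. (3.7) (p. 22)] [cite: Schmid1973, §3 and (4.12) (cite only)] -/
theorem hodgeLocusOfNormLe_eq_univ_or_finite_of_lift_of_compactification [PreconnectedSpace S] {p : ℤ} (hpk : p + p = k) (K : ℤ)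
    -- holomorphic-lift interior charts at every point
    (hint : ∀ x : S, ∃ ψ : OpenPartialHomeomorph S ℂ, x ∈ ψ.source ∧
      ∃ (e : ∀ c : ℂ, D.V.fiber (ψ.symm c) ≃ₗ[ℚ] V) (H₀ : HodgeStructure V k) (P₀ : H₀.Polarization) (g h : ℂ → Module.End ℂ (ℂ ⊗[ℚ] V))
        (Λ₀ : Submodule ℤ V),
        (∀ c ∈ ψ.target, ∀ w, g c (h c w) = w) ∧ (∀ c ∈ ψ.target, ∀ w, h c (g c w) = w) ∧
        (∀ (φ : Module.Dual ℂ (ℂ ⊗[ℚ] V)) (w : ℂ ⊗[ℚ] V), AnalyticOnNhd ℂ (fun c => φ (h c w)) ψ.target) ∧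
        (∀ (w : ℂ ⊗[ℚ] V) (φ : (ℂ ⊗[ℚ] V) →ₗ[ℂ] ℂ), Tendsto (fun c => φ (g c w)) (𝓝 (ψ x)) (𝓝 (φ w))) ∧
        (∀ c ∈ ψ.target, ∀ q : ℤ, ((D.hodge (ψ.symm c)).F q).map ((e c).toLinearMap.baseChange ℂ) = (H₀.F q).map (g c)) ∧
        (∀ c ∈ ψ.target, ∀ x y : D.V.fiber (ψ.symm c), (D.form (ψ.symm c)).form x y = P₀.form (e c x) (e c y)) ∧
        Λ₀.FG ∧ (∀ c ∈ ψ.target, ∀ u : D.VZ.fiber (ψ.symm c), e c (D.toRat (ψ.symm c) u) ∈ Λ₀) ∧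
        (∀ c ∈ ψ.target, ∀ v ∈ Λ₀, ∃ u : D.VZ.fiber (ψ.symm c), e c (D.toRat (ψ.symm c) u) = v))
    -- puncture charts
    {ι : Type*} (L : ι → PolarizedLimitMixedHodgeStructure V k) (Γ : ι → ℂ → Module.End ℂ (ℂ ⊗[ℚ] V)) (hΓ0 : ∀ i, Γ i 0 = 0)
    (hΓan : ∀ (i : ι) (φ : Module.Dual ℂ (ℂ ⊗[ℚ] V)) (w : ℂ ⊗[ℚ] V), AnalyticAt ℂ (fun s => φ (Γ i s w)) 0)
    (hΓb : ∀ (i : ι) (s : ℂ), Γ i s ∈ ⨆ ab ∈ {ab : ℤ × ℤ | ab.1 ≤ -1}, (L i).toMixedHodgeStructure.endPiece ab.1 ab.2)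
    (Λ : ι → Submodule ℤ V) (hΛ : ∀ i, (Λ i).FG) (hΛT : ∀ i, ∀ u ∈ Λ i, (L i).monodromy u ∈ Λ i)
    (σ : ι → ℂ → S) (e : ∀ (i : ι) (z : ℂ), D.V.fiber (σ i z) ≃ₗ[ℚ] V) (A₀ : ι → ℝ)
    (hF : ∀ (i : ι) (z : ℂ), A₀ i ≤ z.im → ((D.hodge (σ i z)).F p).map ((e i z).toLinearMap.baseChange ℂ) =
      (((L i).F p).map (IsNilpotent.exp (Γ i (Complex.exp (2 * Real.pi * Complex.I * z))))).map (IsNilpotent.exp (z • (L i).N.baseChange ℂ)))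
    (hQ : ∀ (i : ι) (z : ℂ), A₀ i ≤ z.im → ∀ x y : D.V.fiber (σ i z), (D.form (σ i z)).form x y = (L i).Q (e i z x) (e i z y))
    (hΛ₁ : ∀ (i : ι) (z : ℂ), A₀ i ≤ z.im → ∀ u : D.VZ.fiber (σ i z), e i z (D.toRat (σ i z) u) ∈ Λ i)
    (hΛ₂ : ∀ (i : ι) (z : ℂ), A₀ i ≤ z.im → ∀ v ∈ Λ i, ∃ u : D.VZ.fiber (σ i z), e i z (D.toRat (σ i z) u) = v)
    -- the compactification with disc charts at the punctures
    {j : S → X} (hj : IsEmbedding j) (pt : ι → X) (hpS : ∀ i, pt i ∉ range j) (hcov : ∀ x : X, x ∉ range j → ∃ i, x = pt i)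
    (φ : ι → OpenPartialHomeomorph X ℂ) (hp : ∀ i, pt i ∈ (φ i).source) (hφp : ∀ i, φ i (pt i) = 0)
    (hball : ∀ i, Metric.ball (0 : ℂ) (Real.exp (-(2 * Real.pi * A₀ i))) ⊆ (φ i).target)
    (hσ : ∀ (i : ι) (z : ℂ), A₀ i < z.im → j (σ i z) = (φ i).symm (Complex.exp (2 * Real.pi * Complex.I * z))) :
    D.hodgeLocusOfNormLe p K = univ ∨ (D.hodgeLocusOfNormLe p K).Finite :=
  D.hodgeLocusOfNormLe_eq_univ_or_finite_of_lift hpk K hint L Γ hΓ0 hΓan hΓb Λ hΛ hΛT σ e A₀ hF hQ hΛ₁ hΛ₂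
    (Literature.Topology.isOpen_image_ends hj φ A₀ hball σ hσ)
    (Literature.Topology.exists_isCompact_core hj pt hpS hcov φ hp hφp A₀ hball σ hσ)

/-! ## §3 Corollary 1.3 (`r = 1`) over a punctured compact curve -/

/-- **Cattani–Deligne–Kaplan, COROLLARY 1.3 for `D : VHSData S k` (`k = p + p`) over a PUNCTURED COMPACT CURVE.**  `u₀ ∈ V_ℤ,s₀` («a section of the
local system `𝒱_ℤ` on a universal covering of `S`»); flat interior charts and flat unipotent puncture charts as in
`determinationLocus_eq_univ_or_finite`; compactification, disc charts and uniformisations as in §1.  Then **the set of `t ∈ S` where SOME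
determination `γ · u₀` is of type `(p, p)` is ALL of `S` or FINITE** («is an algebraic subvariety of `S`», on the curve `S = S̄ ∖ {pt i}`).
[cite: CattaniDeligneKaplan1995, Cor. 1.3 (p. 484), Thm. 1.1, Thm. 1.5, «Proof of 1.5 ⟹ 1.1» (p. 485), 2.3 (p. 487)] [cite: Schmid1973, §2 (cite only)] -/
theorem determinationLocus_eq_univ_or_finite_of_compactification [PreconnectedSpace S] {p : ℤ} (hpk : p + p = k) {s₀ : S}
    (u₀ : D.VZ.fiber s₀)
    -- flat interior charts at every point
    (hint : ∀ x : S, ∃ ψ : OpenPartialHomeomorph S ℂ, x ∈ ψ.source ∧ IsPreconnected ψ.target ∧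
      ∃ (e : ∀ c : ℂ, D.V.fiber (ψ.symm c) ≃ₗ[ℚ] V) (H₀ : HodgeStructure V k) (P₀ : H₀.Polarization) (h : ℂ → Module.End ℂ (ℂ ⊗[ℚ] V))
        (Λ₀ : Submodule ℤ V) (κ : ℝ),
        (∀ (φ : Module.Dual ℂ (ℂ ⊗[ℚ] V)) (w : ℂ ⊗[ℚ] V), AnalyticOnNhd ℂ (fun c => φ (h c w)) ψ.target) ∧
        (∀ c ∈ ψ.target, ((D.hodge (ψ.symm c)).F p).map ((e c).toLinearMap.baseChange ℂ) = (H₀.F p).comap (h c)) ∧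
        Λ₀.FG ∧ (∀ c ∈ ψ.target, ∀ u : D.VZ.fiber (ψ.symm c), e c (D.toRat (ψ.symm c) u) ∈ Λ₀) ∧
        0 < κ ∧ (∀ c ∈ ψ.target, ∀ x : D.V.fiber (ψ.symm c), κ * P₀.hodgeNorm (ofRat (e c x)) ≤ (D.form (ψ.symm c)).hodgeNorm (ofRat x)) ∧
        (∀ c ∈ ψ.target, ∀ c' ∈ ψ.target, ∃ δ : Path.Homotopic.Quotient (ψ.symm c) (ψ.symm c'),
          ∀ y : D.V.fiber (ψ.symm c), e c' (D.V.transport δ y) = e c y))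
    -- flat puncture charts
    {ι : Type*} (L : ι → PolarizedLimitMixedHodgeStructure V k) (Γ : ι → ℂ → Module.End ℂ (ℂ ⊗[ℚ] V)) (hΓ0 : ∀ i, Γ i 0 = 0)
    (hΓan : ∀ (i : ι) (φ : Module.Dual ℂ (ℂ ⊗[ℚ] V)) (w : ℂ ⊗[ℚ] V), AnalyticAt ℂ (fun s => φ (Γ i s w)) 0)
    (hΓb : ∀ (i : ι) (s : ℂ), Γ i s ∈ ⨆ ab ∈ {ab : ℤ × ℤ | ab.1 ≤ -1}, (L i).toMixedHodgeStructure.endPiece ab.1 ab.2)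
    (Λ : ι → Submodule ℤ V) (hΛ : ∀ i, (Λ i).FG) (hΛT : ∀ i, ∀ u ∈ Λ i, (L i).monodromy u ∈ Λ i)
    (σ : ι → ℂ → S) (e : ∀ (i : ι) (z : ℂ), D.V.fiber (σ i z) ≃ₗ[ℚ] V) (A₀ : ι → ℝ)
    (hF : ∀ (i : ι) (z : ℂ), A₀ i ≤ z.im → ((D.hodge (σ i z)).F p).map ((e i z).toLinearMap.baseChange ℂ) =
      (((L i).F p).map (IsNilpotent.exp (Γ i (Complex.exp (2 * Real.pi * Complex.I * z))))).map (IsNilpotent.exp (z • (L i).N.baseChange ℂ)))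
    (hQ : ∀ (i : ι) (z : ℂ), A₀ i ≤ z.im → ∀ x y : D.V.fiber (σ i z), (D.form (σ i z)).form x y = (L i).Q (e i z x) (e i z y))
    (hΛ₁ : ∀ (i : ι) (z : ℂ), A₀ i ≤ z.im → ∀ u : D.VZ.fiber (σ i z), e i z (D.toRat (σ i z) u) ∈ Λ i)
    (hflat : ∀ (i : ι) (z z' : ℂ), A₀ i ≤ z.im → A₀ i ≤ z'.im → ∃ δ : Path.Homotopic.Quotient (σ i z) (σ i z'),
      ∀ y : D.V.fiber (σ i z), e i z' (D.V.transport δ y) = e i z y)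
    -- the compactification with disc charts at the punctures
    {j : S → X} (hj : IsEmbedding j) (pt : ι → X) (hpS : ∀ i, pt i ∉ range j) (hcov : ∀ x : X, x ∉ range j → ∃ i, x = pt i)
    (φ : ι → OpenPartialHomeomorph X ℂ) (hp : ∀ i, pt i ∈ (φ i).source) (hφp : ∀ i, φ i (pt i) = 0)
    (hball : ∀ i, Metric.ball (0 : ℂ) (Real.exp (-(2 * Real.pi * A₀ i))) ⊆ (φ i).target)
    (hσ : ∀ (i : ι) (z : ℂ), A₀ i < z.im → j (σ i z) = (φ i).symm (Complex.exp (2 * Real.pi * Complex.I * z))) :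
    {t : S | ∃ γ : Path.Homotopic.Quotient s₀ t, D.IsHodgeAt t p (D.VZ.transport γ u₀)} = univ ∨
      {t : S | ∃ γ : Path.Homotopic.Quotient s₀ t, D.IsHodgeAt t p (D.VZ.transport γ u₀)}.Finite :=
  D.determinationLocus_eq_univ_or_finite hpk u₀ hint L Γ hΓ0 hΓan hΓb Λ hΛ hΛT σ e A₀ hF hQ hΛ₁ hflat
    (Literature.Topology.isOpen_image_ends hj φ A₀ hball σ hσ)
    (Literature.Topology.exists_isCompact_core hj pt hpS hcov φ hp hφp A₀ hball σ hσ)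

/-! ## §4 Reading off: the topological part of the model alone gives the two hypotheses of every one-dimensional CDK assembly -/

omit [FiniteDimensional ℚ V] in
/-- **The model supplies `hopen` AND `hcore` at once** (for re-use by the other one-dimensional assemblies of the tree, e.g. the barrier junction
`Barriers/HodgeConjecture/HodgeLocusAlgebraicOverCurve` §3 and `VHSDataHodgeLocusGenericClass`): `X` compact, `j` an embedding with
`X ∖ j(S) ⊆ {pt i}`, `pt i ∉ j(S)`, disc charts centred at the `pt i` containing `D(e^{−2πA₀ i})`, `j (σ i z) = (φ i)⁻¹(e^{2πiz})` on `{Im z > A₀ i}`.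
[cite: CattaniDeligneKaplan1995, «Proof of 1.5 ⟹ 1.1» (p. 485) and 2.3 (p. 487)] -/
theorem ends_open_and_core_compact_of_compactification {ι : Type*} (σ : ι → ℂ → S) (A₀ : ι → ℝ) {j : S → X} (hj : IsEmbedding j)
    (pt : ι → X) (hpS : ∀ i, pt i ∉ range j) (hcov : ∀ x : X, x ∉ range j → ∃ i, x = pt i) (φ : ι → OpenPartialHomeomorph X ℂ)
    (hp : ∀ i, pt i ∈ (φ i).source) (hφp : ∀ i, φ i (pt i) = 0)
    (hball : ∀ i, Metric.ball (0 : ℂ) (Real.exp (-(2 * Real.pi * A₀ i))) ⊆ (φ i).target)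
    (hσ : ∀ (i : ι) (z : ℂ), A₀ i < z.im → j (σ i z) = (φ i).symm (Complex.exp (2 * Real.pi * Complex.I * z))) :
    (∀ (i : ι) (A : ℝ), A₀ i ≤ A → IsOpen (σ i '' {z : ℂ | A < z.im})) ∧
      ∀ A : ι → ℝ, (∀ i, A₀ i ≤ A i) → ∃ C : Set S, IsCompact C ∧ C ∪ ⋃ i, σ i '' {z : ℂ | A i < z.im} = univ :=
  ⟨Literature.Topology.isOpen_image_ends hj φ A₀ hball σ hσ,
    Literature.Topology.exists_isCompact_core hj pt hpS hcov φ hp hφp A₀ hball σ hσ⟩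

/-- **Cor. 1.3 over a punctured compact curve, read off**: if infinitely many points of `S` carry SOME determination of `u₀` of type `(p, p)`, then
every point does. [cite: CattaniDeligneKaplan1995, Cor. 1.3 (p. 484)] -/
theorem determinationLocus_eq_univ_of_infinite {p : ℤ} {s₀ : S} {u₀ : D.VZ.fiber s₀}
    (h : {t : S | ∃ γ : Path.Homotopic.Quotient s₀ t, D.IsHodgeAt t p (D.VZ.transport γ u₀)} = univ ∨
      {t : S | ∃ γ : Path.Homotopic.Quotient s₀ t, D.IsHodgeAt t p (D.VZ.transport γ u₀)}.Finite)
    (hinf : {t : S | ∃ γ : Path.Homotopic.Quotient s₀ t, D.IsHodgeAt t p (D.VZ.transport γ u₀)}.Infinite) :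
    {t : S | ∃ γ : Path.Homotopic.Quotient s₀ t, D.IsHodgeAt t p (D.VZ.transport γ u₀)} = univ :=
  h.resolve_right hinf

end Motives.VHSData

end Literature.AlgebraicGeometry

end
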